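import Summits.CriticalPhenomena.CardyFormulaZ2.Theses.CardyIKTransport
import Literature.Probability.Percolation.CardyFormulaConformalInvariance
import Literature.Probability.RandomPlanarGeometry.ConformalRectangleProofs
import Literature.Probability.RandomPlanarGeometry.ImageUnivalent
import Literature.Probability.RandomPlanarGeometry.CardyFunctionIncBeta

/-!
# `IKLinearTransport` (route `CardyIKTransport`, stmt-CriticalPhenomena-5076): what the crux is
# equivalent to, and what it forces

Negative-side support for the crux `CardyIKTransport.IKLinearTransport` (cdisprove unit, refuter
`refuter-cdisprove-stmt-CriticalPhenomena-5076-0`; work file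
`Cruxes/IKLinearTransport/Disproof.lean`). The crux asserts a real-linear automorphism `K` of `ℂ`
conjugating the `δ → 0⁺` limits of the crude crossing probabilities `P_IK` of the isotropic
Izergin–Korepin cell model (explicit i.i.d.-bit gauge) with those of critical site percolation on
`𝕋` read on the `K`-images of the rectangles (`∃ K, ∀ R L, P_IK R → L ↔ tri (R.map K) → L`).

* §0 `Pik`, `ConjugateToTri` (the conclusion TEMPLATE for an arbitrary family), `crux_iff_conjugateToTri`
  (`Iff.rfl`).
* §1 `conjugateToTri_iff_cardyOnImages`, `crux_iff_cardyOnImages`: with Smirnov's theorem (proved in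
  the tree, `hasCrossingLimit_triDomainCrossingProb_holds`) and `exists_isUniformizing_holds`, the
  template is EQUIVALENT to Cardy's formula for `P` read on `K`-images,
  `∀ R, (R.map K).HasCrossingLimit (P R) cardyFunction`; the `∀ L, … ↔ …` shape is not weaker.
  `cardyOnImages_congr_mul` / `conjugateToTri_congr_mul`: `K` is determined at most up to a
  conformal similarity `z ↦ c z` on the left (the crux alone never pins `K`).
* §2 `crux_forces_limits_mem_Ioo`: the crux forces, for EVERY conformal rectangle, convergence of
  `P_IK R` to a limit in `(0,1)`; kill shapes `not_conjugateToTri_of_tendsto` (a limit outside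
  `(0,1)` somewhere) and `not_conjugateToTri_of_not_tendsto` (no limit somewhere) refute the template
  for every `K`. Any proof must deliver RSW-type two-sided bounds for the non-FKG IK field in every
  Jordan rectangle; any disproof needs one bad rectangle. Used by `LoadBearing.lean` (the
  `_false_without_` certificates).
-/

noncomputable section

namespace Summit.CriticalPhenomena.CardyFormulaZ2.Theorems.IKLinearTransport.Negative

open scoped Classical
open Filter Topology Set MeasureTheory
open Literature.Probability.Percolation Literature.Probability.LatticeModels
open Literature.Probability.RandomPlanarGeometry

/-! ## §0 The crux, verbatim -/

/-- The crux's inline family `P_IK` (verbatim copy of the `let`-bound family of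
`CardyIKTransport.IKLinearTransport`, so that `crux_iff_conjugateToTri` is `Iff.rfl`). [folklore] -/
def Pik : ConformalRectangle → ℝ → ℝ := (fun R => let μ := (Literature.Probability.Percolation.sitePercolation ℤ Literature.Probability.Percolation.half).prod ((Literature.Probability.Percolation.sitePercolation ℤ Literature.Probability.Percolation.half).prod ((Literature.Probability.Percolation.sitePercolation (Literature.Probability.LatticeModels.Site 2) (Set.projIcc (0:ℝ) 1 zero_le_one (2 * Real.sqrt 3 - 3))).prod ((Literature.Probability.Percolation.sitePercolation (Literature.Probability.LatticeModels.Site 2) Literature.Probability.Percolation.half).prod (Literature.Probability.Percolation.sitePercolation (Literature.Probability.LatticeModels.Site 2) Literature.Probability.Percolation.half)))); let par : (Set ℤ × (Set ℤ × (Set (Literature.Probability.LatticeModels.Site 2) × (Set (Literature.Probability.LatticeModels.Site 2) × Set (Literature.Probability.LatticeModels.Site 2))))) → Literature.Probability.LatticeModels.Site 2 → Prop := fun ω f => (f 0 ∈ (Set.univ : Set ℤ) ∧ f ∈ ω.2.2.1) ∨ (f 0 ∉ (Set.univ : Set ℤ) ∧ f ∈ ω.2.2.2.1); let blk : (Set ℤ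 × (Set ℤ × (Set (Literature.Probability.LatticeModels.Site 2) × (Set (Literature.Probability.LatticeModels.Site 2) × Set (Literature.Probability.LatticeModels.Site 2))))) → Literature.Probability.LatticeModels.Site 2 → Prop := fun ω v => Xor (v 0 ∈ ω.1) (Xor (v 1 ∈ ω.2.1) (Odd ((Finset.filter (fun f : ℤ × ℤ => par ω ![f.1, f.2]) (Finset.Ico (min 0 (v 0)) (max 0 (v 0)) ×ˢ Finset.Ico (min 0 (v 1)) (max 0 (v 1)))).card))); let anti : (Set ℤ × (Set ℤ × (Set (Literature.Probability.LatticeModels.Site 2) × (Set (Literature.Probability.LatticeModels.Site 2) × Set (Literature.Probability.LatticeModels.Site 2))))) → Literature.Probability.LatticeModels.Site 2 → Prop := fun ω f => f 0 ∉ (Set.univ : Set ℤ) ∨ f ∈ ω.2.2.2.2; let edges : (Set ℤ × (Set ℤ × (Set (Literature.Probability.LatticeModels.Site 2) × (Set (Literature.Probability.LatticeModels.Site 2) × Set (Literature.Probability.LatticeModels.Site 2))))) → Literature.Probability.Percolation.BondConfig (Literature.Probability.LatticeModels.Site 2) := fun ω => {e | ∃ u v, e = s(u, v) ∧ blk ω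 u ∧ blk ω v ∧ (v = u + ![1, 0] ∨ v = u + ![0, 1] ∨ (v = u + ![1, 1] ∧ ¬ anti ω u) ∨ (v = u + ![1, -1] ∧ anti ω (u + ![0, -1])))}; fun δ : ℝ => μ.real {ω | edges ω ∈ Literature.Probability.Percolation.embDomainCrossing (fun v : Literature.Probability.LatticeModels.Site 2 => ((v 0 : ℝ) : ℂ) + ((v 1 : ℝ) : ℂ) * Complex.I) R.carrier δ (R.arc 0) (R.arc 2)})

/-- TEMPLATE of the crux's conclusion for an arbitrary family `P` of crossing functions:
`P` is linearly conjugate to critical site percolation on `𝕋` through `K`. [folklore] -/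
def ConjugateToTri (P : ConformalRectangle → ℝ → ℝ) (K : ℂ ≃L[ℝ] ℂ) : Prop :=
  ∀ (R : ConformalRectangle) (L : ℝ), Tendsto (P R) (𝓝[>] 0) (𝓝 L) ↔
    Tendsto (triDomainCrossingProb (R.map K.toHomeomorph)) (𝓝[>] 0) (𝓝 L)

/-- Cardy's formula for `P`, with the modulus read on the `K`-images of the rectangles. [folklore] -/
def CardyOnImages (P : ConformalRectangle → ℝ → ℝ) (K : ℂ ≃L[ℝ] ℂ) : Prop :=
  ∀ R : ConformalRectangle,
    ConformalRectangle.HasCrossingLimit (R.map K.toHomeomorph) (P R)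
      Literature.Probability.RandomPlanarGeometry.cardyFunction

/-- The crux is the template at `P := Pik` (definitional). [folklore] -/
theorem crux_iff_conjugateToTri :
    Summit.CriticalPhenomena.CardyFormulaZ2.Theses.CardyIKTransport.IKLinearTransport ↔
      ∃ K : ℂ ≃L[ℝ] ℂ, ConjugateToTri Pik K :=
  Iff.rfl

/-! ## §1 Reformulation: the `↔`-shape is exactly Cardy on `K`-images -/

/-- Smirnov's theorem (tree) + existence of uniformizing data (tree) + uniqueness of limits:
`ConjugateToTri P K ↔ CardyOnImages P K` for EVERY family `P`. [folklore] -/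
theorem conjugateToTri_iff_cardyOnImages (P : ConformalRectangle → ℝ → ℝ) (K : ℂ ≃L[ℝ] ℂ) :
    ConjugateToTri P K ↔ CardyOnImages P K := by
  constructor
  · intro h R φ x hφx
    exact (h R _).2 (hasCrossingLimit_triDomainCrossingProb_holds _ φ x hφx)
  · intro h R L
    obtain ⟨φ, x, hφx⟩ := MarkedDomain.exists_isUniformizing_holds (R.map K.toHomeomorph)
    have hP : Tendsto (P R) (𝓝[>] 0)
        (𝓝 (Literature.Probability.RandomPlanarGeometry.cardyFunction (crossRatio x))) := h R φ x hφx
    have hT : Tendsto (triDomainCrossingProb (R.map K.toHomeomorph)) (𝓝[>] 0)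
        (𝓝 (Literature.Probability.RandomPlanarGeometry.cardyFunction (crossRatio x))) :=
      hasCrossingLimit_triDomainCrossingProb_holds _ φ x hφx
    constructor
    · intro hL
      rw [tendsto_nhds_unique hL hP]
      exact hT
    · intro hL
      rw [tendsto_nhds_unique hL hT]
      exact hP

/-- The crux ⟺ `∃ K, CardyOnImages P_IK K`: Cardy's formula for the isotropic IK crude crossing
probabilities in every conformal rectangle, modulus read after an unknown linear map. [folklore] -/
theorem crux_iff_cardyOnImages :
    Summit.CriticalPhenomena.CardyFormulaZ2.Theses.CardyIKTransport.IKLinearTransport ↔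
      ∃ K : ℂ ≃L[ℝ] ℂ, CardyOnImages Pik K := by
  rw [crux_iff_conjugateToTri]
  exact exists_congr fun K => conjugateToTri_iff_cardyOnImages Pik K

/-! ### `K` is determined at most up to a conformal similarity -/

/-- Composition of images of marked domains under plane homeomorphisms. [folklore] -/
theorem markedDomain_map_map {n : ℕ} (D : MarkedDomain n) (φ ψ : ℂ ≃ₜ ℂ) :
    (D.map φ).map ψ = D.map (φ.trans ψ) := by
  obtain ⟨⟨c, b, h1, h2, h3, h4, h5, h6, h7⟩, mark, hm, hm'⟩ := D
  simp only [MarkedDomain.map, JordanDomain.map, MarkedDomain.mk.injEq, and_true]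
  congr 1
  exact Set.image_image _ _ _

/-- Post-composing the image with a complex dilation-rotation `z ↦ c z` (`c ≠ 0`) does not change
crossing limits read through Cardy's function: the modulus of `c · S` is that of `S`
(`hasCrossingLimit_iff_of_image_data` of the tree, Pommerenke 1992 Cor. 2.7). [folklore] -/
theorem hasCrossingLimit_map_mulLeft_iff (S : ConformalRectangle) {c : ℂ} (hc : c ≠ 0)
    (p F : ℝ → ℝ) :
    ConformalRectangle.HasCrossingLimit (S.map (Homeomorph.mulLeft₀ c hc)) p F ↔
      S.HasCrossingLimit p F :=
  ConformalRectangle.hasCrossingLimit_iff_of_image_data (R := S)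
    (S := S.map (Homeomorph.mulLeft₀ c hc)) (h := fun z => c * z)
    ((differentiable_id.const_mul c).differentiableOn) (mul_right_injective₀ hc).injOn
    (continuous_const.mul continuous_id).continuousOn rfl fun _ => rfl

/-- NON-UNIQUENESS OF `K`. If `P` is Cardy on `K`-images then it is Cardy on `K'`-images for every
`K' = c · K`, `c ∈ ℂˣ`: the crux determines its linear map at most up to a conformal similarity on
the left (pinning `K` further is the job of the route's `AnchorByRigidity`/`IKQuarterTurn`, not of
the crux). [folklore] -/
theorem cardyOnImages_congr_mul {P : ConformalRectangle → ℝ → ℝ} {K K' : ℂ ≃L[ℝ] ℂ} {c : ℂ}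
    (hc : c ≠ 0) (hK' : ∀ z, K' z = c * K z) : CardyOnImages P K ↔ CardyOnImages P K' := by
  have hhom : K'.toHomeomorph = K.toHomeomorph.trans (Homeomorph.mulLeft₀ c hc) :=
    Homeomorph.ext fun z => hK' z
  have hmap : ∀ R : ConformalRectangle,
      R.map K'.toHomeomorph = (R.map K.toHomeomorph).map (Homeomorph.mulLeft₀ c hc) := fun R => by
    rw [hhom, markedDomain_map_map]
  constructor
  · intro h R
    rw [hmap, hasCrossingLimit_map_mulLeft_iff]
    exact h R
  · intro h R
    have := h R
    rw [hmap, hasCrossingLimit_map_mulLeft_iff] at this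
    exact this

/-- The same non-uniqueness for the crux's template. [folklore] -/
theorem conjugateToTri_congr_mul {P : ConformalRectangle → ℝ → ℝ} {K K' : ℂ ≃L[ℝ] ℂ} {c : ℂ}
    (hc : c ≠ 0) (hK' : ∀ z, K' z = c * K z) : ConjugateToTri P K ↔ ConjugateToTri P K' := by
  rw [conjugateToTri_iff_cardyOnImages, conjugateToTri_iff_cardyOnImages]
  exact cardyOnImages_congr_mul hc hK'

/-! ## §2 Necessary condition: limits exist and lie in `(0,1)` for every rectangle -/

/-- Cardy's function maps `(0,1)` into `(0,1)` (strict monotonicity on `[0,1]`, `F 0 = 0`,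
`F 1 = 1`; all proved in the tree). [folklore] -/
theorem cardyFunction_mem_Ioo {η : ℝ} (h : η ∈ Ioo (0 : ℝ) 1) :
    Literature.Probability.RandomPlanarGeometry.cardyFunction η ∈ Ioo (0 : ℝ) 1 := by
  have h0 := strictMonoOn_cardyFunction_holds ⟨le_rfl, zero_le_one⟩ ⟨h.1.le, h.2.le⟩ h.1
  have h1 := strictMonoOn_cardyFunction_holds ⟨h.1.le, h.2.le⟩ ⟨zero_le_one, le_rfl⟩ h.2
  rw [cardyFunction_zero] at h0
  have h1' : Literature.Probability.RandomPlanarGeometry.cardyFunction 1 = 1 := cardyFunction_one_holds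
  rw [h1'] at h1
  exact ⟨h0, h1⟩

/-- A family that is Cardy on `K`-images has, in every rectangle, a limit in `(0,1)`. [folklore] -/
theorem exists_limit_mem_Ioo_of_cardyOnImages {P : ConformalRectangle → ℝ → ℝ} {K : ℂ ≃L[ℝ] ℂ}
    (h : CardyOnImages P K) (R : ConformalRectangle) :
    ∃ L ∈ Ioo (0 : ℝ) 1, Tendsto (P R) (𝓝[>] 0) (𝓝 L) := by
  obtain ⟨φ, x, hφx⟩ := MarkedDomain.exists_isUniformizing_holds (R.map K.toHomeomorph)
  exact ⟨_, cardyFunction_mem_Ioo (ConformalRectangle.crossRatio_mem_Ioo_of_isUniformizing hφx),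
    h R φ x hφx⟩

/-- NECESSARY CONDITION. The crux forces: for every conformal rectangle the crude IK crossing
probabilities converge, as `δ → 0⁺`, to a limit in `(0,1)`. (What a disproof must violate; what
any proof must in particular establish — an RSW-type statement for the non-FKG IK field in
every Jordan rectangle, both bounds.) [folklore] -/
theorem crux_forces_limits_mem_Ioo :
    Summit.CriticalPhenomena.CardyFormulaZ2.Theses.CardyIKTransport.IKLinearTransport →
      ∀ R : ConformalRectangle, ∃ L ∈ Ioo (0 : ℝ) 1, Tendsto (Pik R) (𝓝[>] 0) (𝓝 L) := by
  rw [crux_iff_cardyOnImages]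
  rintro ⟨K, hK⟩ R
  exact exists_limit_mem_Ioo_of_cardyOnImages hK R

/-- KILL SHAPE 1: a rectangle in which `P` tends to a value outside `(0,1)` refutes the template
for every `K`. [folklore] -/
theorem not_conjugateToTri_of_tendsto {P : ConformalRectangle → ℝ → ℝ} (K : ℂ ≃L[ℝ] ℂ)
    {R : ConformalRectangle} {L : ℝ} (hL : L ∉ Ioo (0 : ℝ) 1)
    (h : Tendsto (P R) (𝓝[>] 0) (𝓝 L)) : ¬ ConjugateToTri P K := by
  intro hc
  obtain ⟨L', hL', h'⟩ :=
    exists_limit_mem_Ioo_of_cardyOnImages ((conjugateToTri_iff_cardyOnImages P K).1 hc) R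
  exact hL (tendsto_nhds_unique h h' ▸ hL')

/-- KILL SHAPE 2: a rectangle in which `P` has no limit refutes the template for every `K`. [folklore] -/
theorem not_conjugateToTri_of_not_tendsto {P : ConformalRectangle → ℝ → ℝ} (K : ℂ ≃L[ℝ] ℂ)
    {R : ConformalRectangle} (h : ∀ L : ℝ, ¬ Tendsto (P R) (𝓝[>] 0) (𝓝 L)) :
    ¬ ConjugateToTri P K := by
  intro hc
  obtain ⟨L', -, h'⟩ :=
    exists_limit_mem_Ioo_of_cardyOnImages ((conjugateToTri_iff_cardyOnImages P K).1 hc) R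
  exact h L' h'

/-- The identically-vanishing family is conjugate to nothing (the degenerate gauges "all cells
white" / "no randomness" produce such a family for small `δ`). [folklore] -/
theorem not_conjugateToTri_zero (K : ℂ ≃L[ℝ] ℂ) : ¬ ConjugateToTri (fun _ _ => 0) K :=
  not_conjugateToTri_of_tendsto K (R := Classical.arbitrary ConformalRectangle) (L := 0)
    (fun h => lt_irrefl _ h.1) tendsto_const_nhds

end Summit.CriticalPhenomena.CardyFormulaZ2.Theorems.IKLinearTransport.Negative

end
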